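import Literature.AlgebraicGeometry.PlaneCurves.HessePencilCharacteristicThreeWebNonsingular
import HarnessLib

/-!
# Remark 2.1 over perfect fields of characteristic `3` (finite fields): cube roots replace `K = K̄` (Artebani–Dolgachev)

Topic `Literature/AlgebraicGeometry/PlaneCurves`, namespace `Literature.AlgebraicGeometry.PlaneCurves`.
Lane `lit-hodgefound`, seat `lit-hodgefound-p37`, row g21-#16; refines
`HessePencilCharacteristicThreeWebSingular` / `…WebNonsingular` (g21-#10/#11, stated over `K = K̄`)
and composes with `HessePencilCharacteristicThreeWebForm` (g21-#9).  The ONLY use of algebraic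
closure there is one cube root (the singular point `(b, a, z₀)`, `z₀³ = a²b²/d`, of the web cubic with
`c = 0`); here it is replaced by the hypothesis "every element of `K` is a cube", which holds in every
perfect field of characteristic `3` and is PROVED below for finite `K`.  Everything here is PROVED; no
definition, no named fact.

Source — M. Artebani, I. Dolgachev, *The Hesse pencil of plane cubic curves*, Enseign. Math. (2) 55
(2009), §2, Remark 2.1 [`paper:arxiv-math_0611590` p0005 L58–61], VERBATIM: "The Hesse pencil makes
sense over a field of any characteristic and is popular in number-theory and cryptography for finding
explicit algorithms for computing the number of points of an elliptic curve over a finite field of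
characteristic 3 (see [Ran], [Smart]). […] We find equation (4) and check that it defines a
nonsingular curve only if `abc ≠ 0`.  By scaling the variables we may assume that `a = b = −1, c = 1`.
Next we use the variable change `z = u + x + y` to transform the equation to the Hesse form".

## What is here (`3 = 0`)

* `exists_cube_root_of_finite` — in a finite field with `3 = 0` every element is a cube (`x ↦ x³` is
  injective since `x³ − y³ = (x − y)³`, hence bijective).
* `web_singular_of_c_eq_zero_of_cube`, **`web_singular_iff_of_cube`** — g21-#10/#11 with "every
  element is a cube" in place of `K = K̄`: the web cubic has a singular `K`-point iff `abcd = 0`.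
* **`web_exists_bind₁_eq_smul_hesseE_of_cube`** — a web cubic `xy(ax + by + cz) + dz³` with NO
  singular `K`-point is `K`-projectively equivalent to a nonsingular member: `F ∘ S = κ·E_t`,
  `det S ≠ 0`, `κ ≠ 0`, `t ≠ 0`; `web_exists_bind₁_eq_smul_hesseE_of_finite` — the same over any
  finite field of characteristic `3`.

## References
* [ArtebaniDolgachev2009] M. Artebani, I. Dolgachev, *The Hesse pencil of plane cubic curves*,
  Enseign. Math. (2) 55 (2009) 235–273, §2, Remark 2.1 (with [Smart]: N. Smart, *The Hessian form of
  an elliptic curve*, CHES 2001).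
-/

set_option autoImplicit false

open MvPolynomial Matrix

namespace Literature.AlgebraicGeometry.PlaneCurves

universe u

/-- The member `E_t = X³ + Y³ + Z³ + t·XYZ` (local notation, no definition). -/
local notation3 "𝐄[" t "]" =>
  (X 0 ^ 3 + X 1 ^ 3 + X 2 ^ 3 + C t * (X 0 * X 1 * X 2) : MvPolynomial (Fin 3) _)

/-- The web cubic `F = xy(ax + by + cz) + dz³` (local notation, no definition). -/
local notation3 "𝐅[" a ", " b ", " c ", " d "]" =>
  (X 0 * X 1 * (C a * X 0 + C b * X 1 + C c * X 2) + C d * X 2 ^ 3 : MvPolynomial (Fin 3) _)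

/-- `S = [[−a⁻¹, 0, 0], [0, −b⁻¹, 0], [c⁻¹, c⁻¹, c⁻¹]]` (g21-#9; local notation). -/
local notation3 "𝐒[" a ", " b ", " c "]" =>
  (Matrix.of ![![-a⁻¹, 0, 0], ![0, -b⁻¹, 0], ![c⁻¹, c⁻¹, c⁻¹]] : Matrix (Fin 3) (Fin 3) _)

section CharThreePerfectField

variable {K : Type u} [Field K]

/-- **In a finite field of characteristic `3` every element is a cube**: `x³ − y³ = (x − y)³`, so
cubing is injective, hence bijective. [cite: ArtebaniDolgachev2009, §2, Remark 2.1 ("an elliptic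
curve over a finite field of characteristic 3")] -/
theorem exists_cube_root_of_finite [Finite K] (h3 : (3 : K) = 0) (w : K) : ∃ z : K, z ^ 3 = w := by
  have hinj : Function.Injective fun x : K => x ^ 3 := by
    intro x y hxy
    have h : (x - y) ^ 3 = 0 := by
      have e : (x - y) ^ 3 = x ^ 3 - y ^ 3 := by linear_combination (-(x * y) * (x - y)) * h3
      rw [e, sub_eq_zero]; exact hxy
    exact sub_eq_zero.1 ((pow_eq_zero_iff three_ne_zero).1 h)
  exact Finite.surjective_of_injective hinj w

/-- **`c = 0`, `d ≠ 0`, `3 = 0`, every element a cube: `(b, a, z₀)` with `z₀³ = a²b²/d` is a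
singular `K`-point of `xy(ax + by) + dz³`.** [cite: ArtebaniDolgachev2009, §2, Remark 2.1
("nonsingular curve only if `abc ≠ 0`")] -/
theorem web_singular_of_c_eq_zero_of_cube (h3 : (3 : K) = 0) (hcube : ∀ w : K, ∃ z : K, z ^ 3 = w)
    {a b d : K} (hd : d ≠ 0) :
    ∃ z₀ : K, eval ![b, a, z₀] 𝐅[a, b, (0 : K), d] = 0 ∧
      (fun i => eval ![b, a, z₀] (pderiv i 𝐅[a, b, (0 : K), d])) = 0 := by
  obtain ⟨z₀, hz⟩ := hcube (a ^ 2 * b ^ 2 / d)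
  refine ⟨z₀, ?_, ?_⟩
  · rw [web_eval]
    simp only [Matrix.cons_val_zero, Matrix.cons_val_one, Matrix.cons_val]
    rw [hz, mul_div_cancel₀ _ hd]
    linear_combination (a ^ 2 * b ^ 2) * h3
  · rw [web_eval_pderiv]
    funext i; fin_cases i
    · simp; linear_combination (a ^ 2 * b) * h3
    · simp; linear_combination (a * b ^ 2) * h3
    · simp; left; left; exact h3

/-- **The web cubic has a singular `K`-point iff `abcd = 0`** — `3 = 0`, every element of `K` a cube
(g21-#11's `web_singular_iff_of_three_eq_zero` without algebraic closure). [cite: ArtebaniDolgachev2009,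
§2, Remark 2.1] -/
theorem web_singular_iff_of_cube (h3 : (3 : K) = 0) (hcube : ∀ w : K, ∃ z : K, z ^ 3 = w)
    (a b c d : K) :
    (∃ p : Fin 3 → K, p ≠ 0 ∧ eval p 𝐅[a, b, c, d] = 0 ∧
      (fun i => eval p (pderiv i 𝐅[a, b, c, d])) = 0) ↔ a * b * c * d = 0 := by
  constructor
  · intro h
    by_contra hne
    have ha : a ≠ 0 := fun h0 => hne (by rw [h0]; ring)
    have hb : b ≠ 0 := fun h0 => hne (by rw [h0]; ring)
    have hc : c ≠ 0 := fun h0 => hne (by rw [h0]; ring)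
    have hd : d ≠ 0 := fun h0 => hne (by rw [h0]; ring)
    exact web_nonsingular_of_three_eq_zero h3 ha hb hc hd h
  · intro h
    rcases mul_eq_zero.1 h with habc | hd
    · rcases mul_eq_zero.1 habc with hab | hc
      · rcases mul_eq_zero.1 hab with ha | hb
        · subst ha
          exact ⟨![1, 0, 0], fun h0 => by simpa using congrFun h0 0, web_singular_of_a_eq_zero b c d⟩
        · subst hb
          exact ⟨![0, 1, 0], fun h0 => by simpa using congrFun h0 1, web_singular_of_b_eq_zero a c d⟩
      · subst hc
        by_cases hb : b = 0
        · subst hb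
          exact ⟨![0, 1, 0], fun h0 => by simpa using congrFun h0 1, web_singular_of_b_eq_zero a 0 d⟩
        by_cases hd : d = 0
        · subst hd
          exact ⟨![0, 0, 1], fun h0 => by simpa using congrFun h0 2, web_singular_of_d_eq_zero a b 0⟩
        · obtain ⟨z₀, h1, h2⟩ := web_singular_of_c_eq_zero_of_cube h3 hcube (a := a) (b := b) hd
          exact ⟨![b, a, z₀], fun h0 => hb (by simpa using congrFun h0 0), h1, h2⟩
    · subst hd
      exact ⟨![0, 0, 1], fun h0 => by simpa using congrFun h0 2, web_singular_of_d_eq_zero a b c⟩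

/-- **Remark 2.1 for a web cubic over a field in which every element is a cube** (`3 = 0`): if
`xy(ax + by + cz) + dz³` has no singular `K`-point, then `abcd ≠ 0` and
`F ∘ S = (d/c³)·E_t`, `t = c³/(abd) ≠ 0`, `det S ≠ 0` — a Hesse form OVER `K`.
[cite: ArtebaniDolgachev2009, §2, Remark 2.1] -/
theorem web_exists_bind₁_eq_smul_hesseE_of_cube (h3 : (3 : K) = 0)
    (hcube : ∀ w : K, ∃ z : K, z ^ 3 = w) {a b c d : K}
    (hns : ¬ ∃ p : Fin 3 → K, p ≠ 0 ∧ eval p 𝐅[a, b, c, d] = 0 ∧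
      (fun i => eval p (pderiv i 𝐅[a, b, c, d])) = 0) :
    ∃ (M : Matrix (Fin 3) (Fin 3) K) (κ t : K), M.det ≠ 0 ∧ κ ≠ 0 ∧ t ≠ 0 ∧
      bind₁ M.toMvPolynomial 𝐅[a, b, c, d] = κ • (𝐄[t] : MvPolynomial (Fin 3) K) := by
  have hne : a * b * c * d ≠ 0 := fun h => hns ((web_singular_iff_of_cube h3 hcube a b c d).2 h)
  have ha : a ≠ 0 := fun h0 => hne (by rw [h0]; ring)
  have hb : b ≠ 0 := fun h0 => hne (by rw [h0]; ring)
  have hc : c ≠ 0 := fun h0 => hne (by rw [h0]; ring)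
  have hd : d ≠ 0 := fun h0 => hne (by rw [h0]; ring)
  obtain ⟨hS, ht⟩ := web_bind₁_eq_smul_hesseE h3 ha hb hc hd
  exact ⟨𝐒[a, b, c], d * c⁻¹ ^ 3, c ^ 3 * (a * b * d)⁻¹, (web_matrix_det ha hb hc (K := K)).2,
    mul_ne_zero hd (pow_ne_zero 3 (inv_ne_zero hc)), ht, hS⟩

/-- **… in particular over every finite field of characteristic `3`.** [cite: ArtebaniDolgachev2009,
§2, Remark 2.1 ("an elliptic curve over a finite field of characteristic 3")] -/
theorem web_exists_bind₁_eq_smul_hesseE_of_finite [Finite K] (h3 : (3 : K) = 0) {a b c d : K}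
    (hns : ¬ ∃ p : Fin 3 → K, p ≠ 0 ∧ eval p 𝐅[a, b, c, d] = 0 ∧
      (fun i => eval p (pderiv i 𝐅[a, b, c, d])) = 0) :
    ∃ (M : Matrix (Fin 3) (Fin 3) K) (κ t : K), M.det ≠ 0 ∧ κ ≠ 0 ∧ t ≠ 0 ∧
      bind₁ M.toMvPolynomial 𝐅[a, b, c, d] = κ • (𝐄[t] : MvPolynomial (Fin 3) K) :=
  web_exists_bind₁_eq_smul_hesseE_of_cube h3 (exists_cube_root_of_finite h3) hns

end CharThreePerfectField

end Literature.AlgebraicGeometry.PlaneCurves
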